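import Summits.AnomalousDissipation.AnomalousDissipation.Theorems.SolenoidalFractalHomogenisationLagrangianStepFrameRate
import Literature.Analysis.FluidPDE.PassiveVectorTensorGalerkinSmooth
import HarnessLib

/-!
# K1L_D (stmt-AnomalousDissipation-27980), `stub_Z7_alphaBetaR` (N1′)/(N2) instantiation: the COARSE DRIFT `b_{≤m} = partialSum m` IS A
# `Torus.SmoothCarrier` with gradient constant `C′·Σ_{i<m} a (i+1)` (helper, `--supports 27980 --as helper`; prover ad-k1loc-p3 g9)

Both Eulerian coarse conjuncts of `Z7Glue.cellInputs_alphaBeta_textR` are fed by class-level facts for `Torus.IsPropagator T b 𝔹 U` along a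
`Torus.SmoothCarrier b M G` (ad-lit g29: (N2) = `IsPropagator.loss_later_le`, p704753; (N1′) = the planned R4′ `lossFwd_le_gradNormSq`), with the
constant entering ONLY through `G·(window length)`.  For the coarse drift `b := E.partialSum m` of an `LPermissible`, `Regular` carrier the fields are
in the tree: joint continuity / smooth divergence-free slices (`LevelRegular.continuous_uncurry_partialSum`, `isSmooth_partialSum`,
`isDivFree_partialSum`), a sup bound (`exists_norm_iteratedFDeriv_partialSum_le … 0`), and THE gradient bound `|∂_q b_{≤m,a}(t,x)| ≤ C′·Σ_{i<m} a (i+1)`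
at ALL times (`FrameForm.abs_partialDeriv_partialSum_le`, p696685, under the design's strain ceiling `θ₀ ≤ θs`).  Hence
**`smoothCarrier_partialSum`**; with `LPermissible` (S) `strain m = (Σ a)·R ≤ θ(m+1) ≤ θ₀` the window exponent `2·card·G·(2R) ≤ 12·C′·θ₀` is
m-UNIFORM (`twelve_mul_strain_le`).  NOT (N1′)/(N2), not the stub, not K1L_D, not AD; rung F-D1.A0.
-/

set_option linter.dupNamespace false

noncomputable section

namespace Summit.AnomalousDissipation.AnomalousDissipation.Theorems.SolenoidalFractalHomogenisation.LagrangianStep.FrameForm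

open Set Function Filter
open scoped NNReal
open Literature.Analysis Literature.Analysis.FunctionSpaces Literature.Analysis.FunctionSpaces.Torus
open Literature.Analysis.FluidPDE Literature.Analysis.FluidPDE.LatticeShear

variable {k : ℕ}

/-- **The coarse drift is a smooth carrier**: for every design `W` there are `θs > 0`, `C′ ≥ 0` (the constants of `abs_partialDeriv_partialSum_le`)
such that for every `LPermissible`, `Regular` carrier of design `W` with `N_m² ≤ N_{m+1}` and the template (T4) at `θ₀ ≤ θs`, and every level `m`,
`Torus.SmoothCarrier (E.partialSum m) M (C′·Σ_{i<m} a (i+1))` for some `M`. -/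
theorem smoothCarrier_partialSum (k : ℕ) (W : LatticeWord k) : ∃ θs : ℝ, 0 < θs ∧ ∃ C' : ℝ, 0 ≤ C' ∧
    ∀ (E : LagrangianLatticeCarrier k) (θ₀ : ℝ), E.design = W → θ₀ ≤ θs → E.LPermissible → E.Regular →
      (∀ m, E.N m ^ 2 ≤ E.N (m + 1)) → (∀ m, E.θ (m + 1) * ((E.N (m + 1) : ℝ) / E.N m) ^ (1 / 16 : ℝ) ≤ θ₀) →
      ∀ m : ℕ, ∃ M : ℝ, Torus.SmoothCarrier (E.partialSum m) M (C' * ∑ i ∈ Finset.range m, E.a (i + 1)) := by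
  obtain ⟨θs, hθs, C', hC', H⟩ := abs_partialDeriv_partialSum_le k W
  refine ⟨θs, hθs, C', hC', fun E θ₀ hD hθ hLP hReg hsq hT4 m => ?_⟩
  have hLR := hReg.levelRegular
  obtain ⟨M, hM⟩ := hLR.exists_norm_iteratedFDeriv_partialSum_le m 0
  refine ⟨M, ⟨hLR.continuous_uncurry_partialSum m, hLR.isSmooth_partialSum m, hLR.isDivFree_partialSum m, ?_, ?_, ?_⟩⟩
  · intro t x
    obtain ⟨v, rfl⟩ := proj_surjective x
    have h := hM t v
    rwa [norm_iteratedFDeriv_zero] at h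
  · exact mul_nonneg hC' (Finset.sum_nonneg fun i _ => (E.toFractalCarrierData.a_pos _).le)
  · intro t x c a
    have h1 : IsContDiff 1 (E.partialSum m t) := (hLR.isSmooth_partialSum m t).isContDiff (by simp)
    rw [← partialDeriv_apply_coord h1]
    exact H E θ₀ hD hθ hLP hReg hsq hT4 m t x a c

/-- **The window exponent is m-uniform**: `2·card(Fin 3)·(C′·Σ_{i<m} a (i+1))·(2·refresh (m+1)) = 12·C′·strain m ≤ 12·C′·θ(m+1)` for an
`LPermissible` carrier (clause (S) `strain m ≤ θ (m+1)`), hence `≤ 12·C′·θ₀` under the template binder `θ(m+1)·(N(m+1)/N m)^{1/16} ≤ θ₀`. -/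
theorem window_exponent_le (E : LagrangianLatticeCarrier k) (hLP : E.LPermissible) {C' θ₀ : ℝ} (hC' : 0 ≤ C')
    (hT4 : ∀ m, E.θ (m + 1) * ((E.N (m + 1) : ℝ) / E.N m) ^ (1 / 16 : ℝ) ≤ θ₀) (m : ℕ) :
    2 * ((Fintype.card (Fin 3) : ℝ) * (C' * ∑ i ∈ Finset.range m, E.a (i + 1))) * (2 * E.refresh (m + 1)) ≤ 12 * C' * θ₀ := by
  have hNpos : ∀ m, (0 : ℝ) < E.N m := fun m => by exact_mod_cast E.toFractalCarrierData.N_pos m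
  have hN2 : ∀ m, 2 * E.N m ≤ E.N (m + 1) := hLP.permissible.2.2.1
  have hθm : E.θ (m + 1) ≤ θ₀ := by
    have hNmono : (E.N m : ℝ) ≤ E.N (m + 1) := by
      have h : (2 : ℝ) * E.N m ≤ E.N (m + 1) := by exact_mod_cast hN2 m
      linarith [hNpos m]
    have hr : (1 : ℝ) ≤ ((E.N (m + 1) : ℝ) / E.N m) ^ (1 / 16 : ℝ) :=
      Real.one_le_rpow ((one_le_div (hNpos m)).2 hNmono) (by norm_num)
    calc E.θ (m + 1) = E.θ (m + 1) * 1 := (mul_one _).symm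
      _ ≤ E.θ (m + 1) * ((E.N (m + 1) : ℝ) / E.N m) ^ (1 / 16 : ℝ) := mul_le_mul_of_nonneg_left hr (E.θ_pos _).le
      _ ≤ θ₀ := hT4 m
  have hstrain : (∑ i ∈ Finset.range m, E.a (i + 1)) * E.refresh (m + 1) ≤ θ₀ := by
    have h := hLP.strain_le m
    simp only [LagrangianLatticeCarrier.strain] at h
    exact h.trans hθm
  simp only [Fintype.card_fin, Nat.cast_ofNat]
  nlinarith [mul_le_mul_of_nonneg_left hstrain hC']

end Summit.AnomalousDissipation.AnomalousDissipation.Theorems.SolenoidalFractalHomogenisation.LagrangianStep.FrameForm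

end
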